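import Literature.NumberTheory.EllipticCurves.BSDConductor
import Literature.NumberTheory.EllipticCurves.HasseWeilAbelianConductorProofs
import Literature.NumberTheory.DiophantineGeometry.ConductorRingOfIntegersProofs
import Literature.NumberTheory.DiophantineGeometry.MinimalDiscriminantFiniteProofs
import HarnessLib

/-!
# BSD family: the conductor of `E/ℚ` is the Artin conductor of `V_ℓ E` — reductions (proofs)

Sibling proof file of `Literature.NumberTheory.EllipticCurves.BSDConductor` (D-0014: named facts
stay `def … : Prop`; proofs live in sorry-free sibling files).  Target fact:
`Literature.BSD.conductorNorm_eq_artinConductorNat W ℓ` (bsd.S15, `N_E = N^{(ℓ)}(V_ℓ E)` for `ℓ ∤ N_E`).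

## What is proved here

The printed theorem behind the fact (Silverman, *ATAEC*, §IV.10: Definition of `ε, δ, f` and
Thm. 10.2 (PDF p. 358), Definition of `𝔣(E/K)` (PDF p. 364); §IV.11, Ogg's formula 11.1 (PDF
p. 365), whose residue characteristic `2` case the book does not prove but refers to Saito 1988,
PDF p. 366) is, in the tree's terms,
the C15 named fact `WeierstrassCurve.artinConductorExponent_tate_eq_conductorExponent`
(`a_v(V_ℓ E) = f_v(E)` for every finite place `v ∤ ℓ`, with `f_v` *defined* by Ogg's formula in
`Literature.NumberTheory.DiophantineGeometry.Conductor` and `a_v` the genuine Artin + Swan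
conductor of `Literature.NumberTheory.GaloisRepresentations.ArtinConductor`).  That exponentwise
statement needs the Néron–Ogg–Shafarevich criterion, Tate-curve uniformisation and the Ogg–Saito
formula for Tate modules; it stays a named fact, decomposed place by place in
`Literature.NumberTheory.EllipticCurves.HasseWeilAbelianConductor` (tame and wild parts,
Silverman *ATAEC* Thm. IV.10.2 and IV.11.1; the places of good reduction are settled in
`HasseWeilAbelianConductorProofs`, Silverman *AEC* VII.4.1(b)).  This file proves the *assembly*
from it:

* `WeierstrassCurve.conductorNatOf_geomPoints_eq_conductorNorm_of_not_dvd` — over any number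
  field `K`: from `artinConductorExponent_tate_eq_conductorExponent W ℓ`, for every continuity
  proof `h` and every prime `ℓ ∤ N_{K/ℚ} 𝔣(E/K)`,
  `conductorNatOf (geomPoints W) ℓ h = W.conductorNorm (𝓞 K)`;
* `Literature.NumberTheory.EllipticCurves.conductorNorm_eq_artinConductorNat_of_artinConductorExponent` — over `ℚ`: the target
  fact from `artinConductorExponent_tate_eq_conductorExponent W ℓ` and the folklore bridge
  `W.conductorNorm (𝓞 ℚ) = W.conductorNorm ℤ` (the conductor exponent `f_p` does not depend on
  whether the place `p` is viewed as a prime of `ℤ` or of `𝓞 ℚ`; in the tree this requires the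
  equivariance of Tate's algorithm `WeierstrassCurve.kodairaSymbolAt` under the ring isomorphism
  of completed local rings, cf. `WeierstrassCurve.ordMinimalDiscriminant_eq_padic` for the
  discriminant half), taken as the hypothesis `hB`, and discharged by
  `WeierstrassCurve.conductorNorm_ringOfIntegers_rat`
  (`Literature.NumberTheory.DiophantineGeometry.ConductorRingOfIntegersProofs`) in
  `Literature.NumberTheory.EllipticCurves.conductorNorm_eq_artinConductorNat_of_artinConductorExponent_of_isElliptic`, which
  thus reduces the target fact for elliptic `W` to the single deep input (i); the corrected
  (elliptic-only) facts `…_of_isElliptic` of `BSDConductor` and `HasseWeilAbelian` are likewise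
  reduced to the corrected C15 input
  `WeierstrassCurve.artinConductorExponent_tate_eq_conductorExponent_of_isElliptic`
  (`…_of_isElliptic_of_tate`, section `Elliptic`: the numerical form and the C15 form; the ideal
  form `Literature.NumberTheory.EllipticCurves.conductor_eq_conductorOf_mul_of_isElliptic_of_tate` lives in the sibling
  `BSDConductorIdealFormProofs`; the corrected exponentwise form is the corrected C15 input itself,
  restated in `BSDConductor` as the theorem
  `Literature.NumberTheory.EllipticCurves.conductorExponent_eq_artinConductorExponent_of_isElliptic`; bsd.S15 (a), (b) are proved
  in `BSDConductor`: `Literature.NumberTheory.EllipticCurves.conductorNorm_eq_prod_holds`,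
  `Literature.NumberTheory.EllipticCurves.conductorExponent_eq_of_five_le_holds`, `Literature.NumberTheory.EllipticCurves.conductorExponent_eq_two_of_five_le_holds`);
  further, the corrected numerical fact from the bad-place decomposition of the C15 input in
  `HasseWeilAbelianConductor`/`HasseWeilAbelianConductorProofs` (Silverman *ATAEC* IV.10.2, 11.1):
  `conductorNorm_eq_artinConductorNat_of_isElliptic_of_facts` (four bad-place facts) and, for
  semistable curves, `conductorNorm_eq_artinConductorNat_of_isElliptic_of_isSemistable` (the two
  multiplicative-place facts, i.e. the Tate-curve inputs, only);
* `Literature.NumberTheory.EllipticCurves.conductorExponent_eq_artinConductorExponent_of_artinConductorExponent` and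
  `Literature.NumberTheory.EllipticCurves.conductor_eq_conductorOf_mul_of_artinConductorExponent` — the other two bsd.S15 (d)
  facts of `BSDConductor` (exponentwise and ideal form) from the same input (i) (the ideal form
  for elliptic `W`, using the finiteness of the bad places
  `WeierstrassCurve.finite_setOf_ordMinimalDiscriminant_ne_zero_holds`);
* `Literature.NumberTheory.EllipticCurves.conductorExponent_eq_artinConductorExponent_of_isElliptic_of_tate`,
  `…_iff_of_isElliptic`, `…_of_isElliptic_of_facts'`, `…_of_isElliptic_of_isSemistable` (section
  `Elliptic`) — for *elliptic* `W` the exponentwise schema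
  `Literature.BSD.conductorExponent_eq_artinConductorExponent W ℓ` is equivalent to the corrected C15
  input and follows from the bad-place facts of `HasseWeilAbelianConductor` (Silverman *ATAEC*
  Thm. IV.10.2, IV.11.1); over all `W` the schema is not a theorem (non-split node: `f_v = 0`,
  `a_v ≥ 1` at `v = (2)`), see the docstring of that section, so it has no discharge `…_holds`;
* `Literature.NumberTheory.EllipticCurves.conductorNorm_eq_artinConductorNat_of_conductorNatOf` /
  `WeierstrassCurve.conductorNatOf_geomPoints_eq_conductorNorm_of_artinConductorExponent` — the
  (definitional) equivalence with the C15 form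
  `WeierstrassCurve.conductorNatOf_geomPoints_eq_conductorNorm W ℓ` and the latter's reduction to
  the same two inputs.

**Ellipticity.**  None of the uncorrected named facts involved carries a `[W.IsElliptic]`
hypothesis (a `Prop`-valued `def` does not pick up the unused section instance), so the
reductions from them are stated for every `W : WeierstrassCurve K`; their *input* `hA` is the
printed theorem only for elliptic `W` (for a singular `W` the conductor data are junk and `hA`
fails in general, e.g. for a non-split nodal cubic, whose `V_ℓ` is a ramified character).  The
corrected facts `…_of_isElliptic` (appended to `BSDConductor` and `HasseWeilAbelian`) quantify
`[W.IsElliptic]` explicitly; section `Elliptic` reduces them to the corrected C15 input.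

The number-theoretic input of the assembly: `Ideal.absNorm` is multiplicative on `finprod`s with
`absNorm I = 1 ↔ I = ⊤` (no finiteness of the support is needed: an infinite support gives the
junk value `1` on both sides), and for a place `v ∋ ℓ` one has `ℓ ∣ N v` (`N v ∣ N(ℓ) = ℓ^{[K:ℚ]}`,
`N v ≠ 1`), so that `ℓ ∤ N 𝔣(E/K) = ∏ N v^{f_v}` forces `f_v = 0` at the places above `ℓ`, where
the prime-to-`ℓ` conductor `Literature.NumberTheory.EllipticCurves.conductorOf` omits the factor.

## References

* J. H. Silverman, *Advanced Topics in the Arithmetic of Elliptic Curves*, GTM 151, 1994, §IV.10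
  (Definition of `ε, δ, f` and Thm. 10.2, PDF p. 358; Definition of the conductor, PDF p. 364),
  §IV.11 (Ogg's formula 11.1, PDF p. 365).
* J.-P. Serre, J. Tate, *Good reduction of abelian varieties*, Ann. of Math. 88 (1968), §2.1, Thm 3.
-/

noncomputable section

open scoped Classical NumberField
open IsDedekindDomain

namespace Literature.NumberTheory.EllipticCurves

/-! ### A finprod lemma -/

/-- Dropping from a `finprod` of natural numbers the factors at a finite set of indices `{i | P i}`
does not change the product, provided some `p` divides every non-trivial dropped factor and
`p` does not divide the full product.  (If the support is infinite both products are the junk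
value `1`.) [folklore] -/
theorem finprod_ite_one_eq_of_not_dvd {ι : Type*} {p : ℕ} (P : ι → Prop)
    [DecidablePred P] (g : ι → ℕ) (hP : {i | P i}.Finite)
    (hdiv : ∀ i, P i → g i ≠ 1 → p ∣ g i) (h : ¬ p ∣ ∏ᶠ i, g i) :
    ∏ᶠ i, (if P i then 1 else g i) = ∏ᶠ i, g i := by
  by_cases hfin : (Function.mulSupport g).Finite
  · refine finprod_congr fun i ↦ ?_
    split_ifs with hi
    · by_contra hne
      exact h ((hdiv i hi (Ne.symm hne)).trans (finprod_mem_dvd i hfin))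
    · rfl
  · have hinf : (Function.mulSupport g).Infinite := hfin
    have hsub : Function.mulSupport g \ {i | P i} ⊆
        Function.mulSupport (fun i ↦ if P i then 1 else g i) := by
      intro i hi
      simp only [Set.mem_sdiff, Function.mem_mulSupport, Set.mem_setOf_eq] at hi ⊢
      rw [if_neg hi.2]
      exact hi.1
    rw [finprod_of_infinite_mulSupport hinf,
      finprod_of_infinite_mulSupport ((hinf.sdiff hP).mono hsub)]

end Literature.NumberTheory.EllipticCurves

/-! ### Over a number field: `N^{(ℓ)}(V_ℓ E) = N_{K/ℚ} 𝔣(E/K)` from the exponentwise fact -/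

namespace WeierstrassCurve

open Literature.NumberTheory.EllipticCurves Field

section NumberField

universe u

variable {K : Type u} [Field K] [NumberField K] (W : WeierstrassCurve K) (ℓ : ℕ) [Fact ℓ.Prime]

/-- `Ideal.absNorm` commutes with `finprod` over the finite places (no finiteness hypothesis:
`absNorm I = 1` forces `I = ⊤`, so an infinite support stays infinite,
`MonoidHom.map_finprod_of_preimage_one`). [folklore] -/
theorem absNorm_finprod_heightOneSpectrum (g : HeightOneSpectrum (𝓞 K) → Ideal (𝓞 K)) :
    Ideal.absNorm (∏ᶠ v, g v) = ∏ᶠ v, Ideal.absNorm (g v) := by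
  have hcoe : ∀ I, (Ideal.absNorm (S := 𝓞 K)).toMonoidHom I = Ideal.absNorm I := fun _ ↦ rfl
  have h := MonoidHom.map_finprod_of_preimage_one (Ideal.absNorm (S := 𝓞 K)).toMonoidHom
    (fun I hI ↦ by simpa [hcoe, Ideal.one_eq_top] using hI) g
  simpa only [hcoe] using h

/-- A rational prime `ℓ` divides the norm of every prime `v` of `𝓞 K` above it:
`N v ∣ N (ℓ) = ℓ ^ [K : ℚ]` and `N v ≠ 1`. Neukirch, *Algebraic Number Theory*, I.8. [folklore] -/
theorem dvd_absNorm_of_natCast_mem {ℓ : ℕ} (hℓ : ℓ.Prime) {v : HeightOneSpectrum (𝓞 K)}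
    (hv : (ℓ : 𝓞 K) ∈ v.asIdeal) : ℓ ∣ Ideal.absNorm v.asIdeal := by
  have hle : Ideal.span {(ℓ : 𝓞 K)} ≤ v.asIdeal := (Ideal.span_singleton_le_iff_mem _).mpr hv
  have hdvd := Ideal.absNorm_dvd_absNorm_of_le hle
  rw [Ideal.absNorm_span_singleton] at hdvd
  have hnorm : Algebra.norm ℤ (ℓ : 𝓞 K) = (ℓ : ℤ) ^ Module.finrank ℤ (𝓞 K) := by
    have := Algebra.norm_algebraMap_of_basis (NumberField.RingOfIntegers.basis K) (ℓ : ℤ)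
    rw [Module.finrank_eq_card_chooseBasisIndex]
    simpa using this
  rw [hnorm, Int.natAbs_pow, Int.natAbs_natCast] at hdvd
  obtain ⟨k, -, hk⟩ := (Nat.dvd_prime_pow hℓ).mp hdvd
  have hk0 : k ≠ 0 := by
    rintro rfl
    rw [pow_zero, Ideal.absNorm_eq_one_iff] at hk
    exact v.isPrime.ne_top hk
  rw [hk]
  exact dvd_pow_self ℓ hk0

/-- Only finitely many finite places of `𝓞 K` lie above a rational prime `ℓ`. [folklore] -/
theorem finite_setOf_natCast_mem {ℓ : ℕ} (hℓ : ℓ.Prime) :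
    {v : HeightOneSpectrum (𝓞 K) | (ℓ : 𝓞 K) ∈ v.asIdeal}.Finite := by
  have hne : Ideal.span {(ℓ : 𝓞 K)} ≠ 0 := by
    rw [Ideal.zero_eq_bot, Ne, Ideal.span_singleton_eq_bot]
    exact_mod_cast hℓ.ne_zero
  refine (Ideal.finite_factors hne).subset fun v hv ↦ ?_
  simp only [Set.mem_setOf_eq] at hv ⊢
  exact Ideal.dvd_iff_le.mpr ((Ideal.span_singleton_le_iff_mem _).mpr hv)

/-- **Assembly over a number field.**  For an elliptic curve `E/K` (`W` elliptic over the number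
field `K`) and a prime `ℓ`, *assume* the exponentwise Ogg–Saito/Serre–Tate fact
`WeierstrassCurve.artinConductorExponent_tate_eq_conductorExponent W ℓ` (`a_v(V_ℓ E) = f_v(E)` for
all `v ∤ ℓ`; Silverman, *ATAEC*, §IV.10 Definition (PDF p. 358), Thm. 10.2 and Ogg's formula
IV.11.1; Serre–Tate 1968, §2.1).  Then for every continuity proof `h` of the Galois action on
`V_ℓ E` and every `ℓ` not dividing `N_{K/ℚ} 𝔣(E/K) = W.conductorNorm (𝓞 K)`, the numerical
prime-to-`ℓ` Artin conductor `Literature.conductorNatOf (geomPoints W) ℓ h = N(∏_{v ∤ ℓ} v^{a_v})` equals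
`N_{K/ℚ} 𝔣(E/K) = N(∏_v v^{f_v})`: the factors at `v ∣ ℓ` omitted on the left are `1` on the
right because `ℓ ∣ N v` for `v ∣ ℓ` and `ℓ ∤ N 𝔣(E/K)`.
[cite: SilvermanATAEC1994, §IV.10 Definition of the conductor (PDF p. 364) with Thm. IV.11.1] -/
theorem conductorNatOf_geomPoints_eq_conductorNorm_of_not_dvd
    (hA : W.artinConductorExponent_tate_eq_conductorExponent ℓ)
    (h : Continuous fun x : absoluteGaloisGroup K × RationalTateModule (geomPoints W) ℓ ↦
      rationalTateRepresentation (absoluteGaloisGroup K) (geomPoints W) ℓ x.1 x.2)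
    (hℓ : ¬ ℓ ∣ W.conductorNorm (𝓞 K)) :
    conductorNatOf (geomPoints W) ℓ h = W.conductorNorm (𝓞 K) := by
  have hprime : ℓ.Prime := Fact.out
  -- the exponents of the prime-to-`ℓ` Artin conductor are the `f_v`
  have hexp : conductorOf (geomPoints W) ℓ h =
      ∏ᶠ v : HeightOneSpectrum (𝓞 K),
        if (ℓ : 𝓞 K) ∈ v.asIdeal then 1 else v.asIdeal ^ W.conductorExponent v := by
    unfold conductorOf
    refine finprod_congr fun v ↦ ?_
    split_ifs with hv
    · rfl
    · rw [hA h v hv]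
  -- push `Ideal.absNorm` through both products
  have hL : conductorNatOf (geomPoints W) ℓ h =
      ∏ᶠ v : HeightOneSpectrum (𝓞 K),
        if (ℓ : 𝓞 K) ∈ v.asIdeal then 1 else Ideal.absNorm v.asIdeal ^ W.conductorExponent v := by
    unfold conductorNatOf
    rw [hexp, absNorm_finprod_heightOneSpectrum]
    refine finprod_congr fun v ↦ ?_
    split_ifs <;> simp
  have hR : W.conductorNorm (𝓞 K) =
      ∏ᶠ v : HeightOneSpectrum (𝓞 K), Ideal.absNorm v.asIdeal ^ W.conductorExponent v := by
    unfold conductorNorm WeierstrassCurve.conductor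
    rw [absNorm_finprod_heightOneSpectrum]
    simp
  rw [hR] at hℓ ⊢
  rw [hL]
  refine Literature.NumberTheory.EllipticCurves.finprod_ite_one_eq_of_not_dvd
    (fun v : HeightOneSpectrum (𝓞 K) ↦ (ℓ : 𝓞 K) ∈ v.asIdeal)
    (fun v ↦ Ideal.absNorm v.asIdeal ^ W.conductorExponent v) (finite_setOf_natCast_mem hprime)
    (fun v hv hne ↦ ?_) hℓ
  have hf : W.conductorExponent v ≠ 0 := by
    rintro h0
    rw [h0, pow_zero] at hne
    exact hne rfl
  exact dvd_pow (dvd_absNorm_of_natCast_mem hprime hv) hf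

/-- The C15 named fact `WeierstrassCurve.conductorNatOf_geomPoints_eq_conductorNorm W ℓ` over `ℚ`
(`N^{(ℓ)}(V_ℓ E) = N_E` for `ℓ ∤ N_E = W.conductorNorm ℤ`) from the exponentwise fact
`artinConductorExponent_tate_eq_conductorExponent W ℓ` and the folklore bridge
`W.conductorNorm (𝓞 ℚ) = W.conductorNorm ℤ` (hypothesis `hB`: the conductor exponent at `p` does
not depend on whether `p` is viewed as a prime of `ℤ` or of `𝓞 ℚ`).
[cite: SilvermanATAEC1994, §IV.10 Definition of the conductor (PDF p. 364) with Thm. IV.11.1] -/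
theorem conductorNatOf_geomPoints_eq_conductorNorm_of_artinConductorExponent
    (W : WeierstrassCurve ℚ) (ℓ : ℕ) [Fact ℓ.Prime]
    (hA : W.artinConductorExponent_tate_eq_conductorExponent ℓ)
    (hB : W.conductorNorm (𝓞 ℚ) = W.conductorNorm ℤ) :
    W.conductorNatOf_geomPoints_eq_conductorNorm ℓ := by
  intro h hℓ
  rw [← hB] at hℓ ⊢
  exact conductorNatOf_geomPoints_eq_conductorNorm_of_not_dvd W ℓ hA h hℓ

end NumberField

end WeierstrassCurve

/-! ### The bsd.S15 form over `ℚ` -/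

namespace Literature.NumberTheory.EllipticCurves

open WeierstrassCurve

variable (W : WeierstrassCurve ℚ) (ℓ : ℕ) [Fact ℓ.Prime]

/-- `Literature.BSD.conductorNorm_eq_artinConductorNat W ℓ` is (the symmetric form of) the C15 named fact
`WeierstrassCurve.conductorNatOf_geomPoints_eq_conductorNorm W ℓ`; this is the interim proof
recorded in `BSDConductor`. [cite: SilvermanATAEC1994, Thm. IV.11.1 with §IV.10] -/
theorem conductorNorm_eq_artinConductorNat_of_conductorNatOf
    (hC : W.conductorNatOf_geomPoints_eq_conductorNorm ℓ) :
    conductorNorm_eq_artinConductorNat W ℓ :=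
  fun h hℓ ↦ (hC h hℓ).symm

/-- Conversely the C15 form follows from the bsd.S15 form. [folklore] -/
theorem conductorNatOf_geomPoints_eq_conductorNorm_of
    (hS : conductorNorm_eq_artinConductorNat W ℓ) :
    W.conductorNatOf_geomPoints_eq_conductorNorm ℓ :=
  fun h hℓ ↦ (hS h hℓ).symm

/-- **bsd.S15, `N_E = N^{(ℓ)}(V_ℓ E)`, assembled.**  The named fact
`Literature.BSD.conductorNorm_eq_artinConductorNat W ℓ` for an elliptic curve `E/ℚ` and a prime `ℓ`,
from (i) the exponentwise Ogg–Saito/Serre–Tate fact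
`WeierstrassCurve.artinConductorExponent_tate_eq_conductorExponent W ℓ` (`a_v(V_ℓ E) = f_v(E)`,
`v ∤ ℓ`: Silverman, *ATAEC*, §IV.10 Definition (PDF p. 358) and Thm. 10.2, Ogg's formula IV.11.1
(PDF p. 365; the `p = 2` case is Saito 1988, not proved in the book); Serre–Tate 1968, §2.1) and
(ii) the folklore bridge `W.conductorNorm (𝓞 ℚ) = W.conductorNorm ℤ` (hypothesis `hB`).  Given
these, for `ℓ ∤ N_E` the factor of `𝔣(E/ℚ)` above `ℓ` is trivial (`ℓ ∣ N v` for `v ∣ ℓ`), so the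
prime-to-`ℓ` Artin conductor `∏_{v ∤ ℓ} v^{a_v(V_ℓ E)}` has norm `N_E`.
[cite: SilvermanATAEC1994, §IV.10 Definition of the conductor (PDF p. 364) with Thm. IV.11.1] -/
theorem conductorNorm_eq_artinConductorNat_of_artinConductorExponent
    (hA : W.artinConductorExponent_tate_eq_conductorExponent ℓ)
    (hB : W.conductorNorm (𝓞 ℚ) = W.conductorNorm ℤ) :
    conductorNorm_eq_artinConductorNat W ℓ :=
  conductorNorm_eq_artinConductorNat_of_conductorNatOf W ℓ
    (conductorNatOf_geomPoints_eq_conductorNorm_of_artinConductorExponent W ℓ hA hB)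

/-- **bsd.S15, `N_E = N^{(ℓ)}(V_ℓ E)` for an elliptic curve, from the single deep input.**  For an
elliptic `W / ℚ` and a prime `ℓ`, the named fact `Literature.BSD.conductorNorm_eq_artinConductorNat W ℓ`
follows from the exponentwise Ogg–Saito/Serre–Tate fact
`WeierstrassCurve.artinConductorExponent_tate_eq_conductorExponent W ℓ` alone
(`a_v(V_ℓ E) = f_v(E)` for `v ∤ ℓ`; Silverman, *ATAEC*, §IV.10 Definition and Thm. 10.2, PDF
p. 358, Ogg's formula IV.11.1, PDF p. 365; Serre–Tate 1968, §2.1): the bridge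
`W.conductorNorm (𝓞 ℚ) = W.conductorNorm ℤ` is the theorem
`WeierstrassCurve.conductorNorm_ringOfIntegers_rat` (equivariance of Tate's algorithm under
isomorphisms of DVRs, `Literature.NumberTheory.DiophantineGeometry.TateAlgorithmRingEquivProofs`).
[cite: SilvermanATAEC1994, §IV.10 Definition of the conductor (PDF p. 364) with Thm. IV.11.1] -/
theorem conductorNorm_eq_artinConductorNat_of_artinConductorExponent_of_isElliptic [W.IsElliptic]
    (hA : W.artinConductorExponent_tate_eq_conductorExponent ℓ) :
    conductorNorm_eq_artinConductorNat W ℓ :=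
  conductorNorm_eq_artinConductorNat_of_artinConductorExponent W ℓ hA
    W.conductorNorm_ringOfIntegers_rat

/-- The C15 named fact `WeierstrassCurve.conductorNatOf_geomPoints_eq_conductorNorm W ℓ` for an
elliptic `W / ℚ` from `artinConductorExponent_tate_eq_conductorExponent W ℓ` alone (bridge
discharged by `WeierstrassCurve.conductorNorm_ringOfIntegers_rat`).
[cite: SilvermanATAEC1994, §IV.10 Definition of the conductor (PDF p. 364) with Thm. IV.11.1] -/
theorem _root_.WeierstrassCurve.conductorNatOf_geomPoints_eq_conductorNorm_of_tate_of_isElliptic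
    [W.IsElliptic] (hA : W.artinConductorExponent_tate_eq_conductorExponent ℓ) :
    W.conductorNatOf_geomPoints_eq_conductorNorm ℓ :=
  conductorNatOf_geomPoints_eq_conductorNorm_of_artinConductorExponent W ℓ hA
    W.conductorNorm_ringOfIntegers_rat

/-! ### The other bsd.S15 (d) facts from the same input -/

/-- **bsd.S15 (d), exponentwise form**: `Literature.BSD.conductorExponent_eq_artinConductorExponent W ℓ`
(`f_v(E) = a_v(V_ℓ E)` for `v ∤ ℓ`) is the C15 named fact
`WeierstrassCurve.artinConductorExponent_tate_eq_conductorExponent W ℓ` read from right to left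
(this is the interim proof recorded in `BSDConductor`).
[cite: SilvermanATAEC1994, Thm. IV.11.1 (Ogg's formula) with §IV.10] -/
theorem conductorExponent_eq_artinConductorExponent_of_artinConductorExponent
    (hA : W.artinConductorExponent_tate_eq_conductorExponent ℓ) :
    conductorExponent_eq_artinConductorExponent W ℓ :=
  fun h v hℓ ↦ (hA h v hℓ).symm

/-- For an integer ring `R` of `ℚ`, a rational prime `p` lies in the finite place `v` of `R` iff
`v` is the place above `p` (`Rat.HeightOneSpectrum.primesEquiv`). [folklore] -/
theorem natCast_mem_asIdeal_iff_eq_primesEquiv_symm {R : Type*} [CommRing R] [IsDedekindDomain R]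
    [Algebra R ℚ] [IsFractionRing R ℚ] [IsIntegralClosure R ℤ ℚ] (v : HeightOneSpectrum R)
    {p : ℕ} (hp : p.Prime) :
    (p : R) ∈ v.asIdeal ↔ v = (Rat.HeightOneSpectrum.primesEquiv (R := R)).symm ⟨p, hp⟩ := by
  rw [Equiv.eq_symm_apply]
  have h1 : (p : R) ∈ v.asIdeal ↔ Rat.HeightOneSpectrum.natGenerator v ∣ p := by
    rw [Rat.HeightOneSpectrum.natGenerator_dvd_iff, Ideal.mem_map_of_equiv]
    constructor
    · intro h
      exact ⟨p, h, map_natCast _ p⟩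
    · rintro ⟨x, hx, hxp⟩
      have hx' : x = p := by
        apply (Rat.IsIntegralClosure.intEquiv R).injective
        rw [hxp, map_natCast]
      rwa [hx'] at hx
  rw [h1, Nat.prime_dvd_prime_iff_eq (Rat.HeightOneSpectrum.prime_natGenerator v) hp]
  constructor
  · intro h
    exact Subtype.ext h
  · intro h
    exact congrArg Subtype.val h

/-- **bsd.S15 (d), ideal form**: `Literature.BSD.conductor_eq_conductorOf_mul W ℓ`
(`𝔣(E/ℚ) = 𝔣^{(ℓ)}(V_ℓ E) · v_ℓ ^ {f_ℓ}` for every prime `ℓ`) for an elliptic `W / ℚ`, from the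
C15 named fact `WeierstrassCurve.artinConductorExponent_tate_eq_conductorExponent W ℓ`: both sides
are finite products over the bad places
(`WeierstrassCurve.finite_setOf_ordMinimalDiscriminant_ne_zero_holds`,
`WeierstrassCurve.conductorExponent_le_ordMinimalDiscriminant`), and the prime-to-`ℓ` Artin
conductor omits exactly the factor at the place `v_ℓ` above `ℓ`.  (Ellipticity is needed for the
finiteness; for an infinite support the two junk values would differ.)
[cite: SilvermanATAEC1994, §IV.10 Definition of the conductor (PDF p. 364) with Thm. IV.11.1] -/
theorem conductor_eq_conductorOf_mul_of_artinConductorExponent [W.IsElliptic]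
    (hA : W.artinConductorExponent_tate_eq_conductorExponent ℓ) :
    conductor_eq_conductorOf_mul W ℓ := by
  intro h
  have hprime : ℓ.Prime := Fact.out
  set vℓ : HeightOneSpectrum (𝓞 ℚ) :=
    (Rat.HeightOneSpectrum.primesEquiv (R := 𝓞 ℚ)).symm ⟨ℓ, Fact.out⟩ with hvℓ
  show W.conductor (𝓞 ℚ) = conductorOf (geomPoints W) ℓ h * vℓ.asIdeal ^ W.conductorExponent vℓ
  set f : HeightOneSpectrum (𝓞 ℚ) → Ideal (𝓞 ℚ) := fun v ↦ v.asIdeal ^ W.conductorExponent v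
    with hf
  have hexp : conductorOf (geomPoints W) ℓ h = ∏ᶠ v, if v = vℓ then 1 else f v := by
    unfold conductorOf
    refine finprod_congr fun v ↦ ?_
    simp only [natCast_mem_asIdeal_iff_eq_primesEquiv_symm v hprime, ← hvℓ]
    split_ifs with hv
    · rfl
    · rw [hA h v ((natCast_mem_asIdeal_iff_eq_primesEquiv_symm v hprime).not.mpr hv)]
  have hfin : (Function.mulSupport f).Finite := by
    refine (W.finite_setOf_ordMinimalDiscriminant_ne_zero_holds (A := 𝓞 ℚ)).subset fun v hv ↦ ?_
    simp only [Function.mem_mulSupport, Set.mem_setOf_eq, hf] at hv ⊢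
    intro h0
    have : W.conductorExponent v = 0 :=
      Nat.eq_zero_of_le_zero (h0 ▸ W.conductorExponent_le_ordMinimalDiscriminant v)
    exact hv (by rw [this, pow_zero])
  have hsplit := mul_finprod_cond_ne vℓ hfin
  unfold WeierstrassCurve.conductor
  rw [← hsplit, hexp, mul_comm]
  congr 1
  refine (finprod_congr fun v ↦ ?_).symm
  rw [finprod_eq_if, ← ite_not]

/-! ### The corrected (elliptic-only) facts from the corrected C15 input -/

section Elliptic

/-- **bsd.S15 for elliptic curves, honest form.**  The corrected fact
`Literature.BSD.conductorNorm_eq_artinConductorNat_of_isElliptic W ℓ` (`N_E = N^{(ℓ)}(V_ℓ E)` for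
`ℓ ∤ N_E`, elliptic `W`) from the corrected C15 fact
`WeierstrassCurve.artinConductorExponent_tate_eq_conductorExponent_of_isElliptic W ℓ` alone
(`a_v(V_ℓ E) = f_v(E)` for `v ∤ ℓ`, elliptic `W`: Serre–Tate 1968 §2.1, Silverman *ATAEC*
IV.10.2 and Ogg's formula IV.11.1, PDF pp. 358, 365 — the single deep input, not in reach of
Mathlib), via `conductorNatOf_geomPoints_eq_conductorNorm_of_not_dvd` and the bridge theorem
`WeierstrassCurve.conductorNorm_ringOfIntegers_rat`.
[cite: SilvermanATAEC1994, §IV.10 Definition of the conductor (PDF p. 364) with Thm. IV.11.1] -/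
theorem conductorNorm_eq_artinConductorNat_of_isElliptic_of_tate
    (hA : W.artinConductorExponent_tate_eq_conductorExponent_of_isElliptic ℓ) :
    conductorNorm_eq_artinConductorNat_of_isElliptic W ℓ := by
  intro _ h hℓ
  rw [← W.conductorNorm_ringOfIntegers_rat] at hℓ ⊢
  exact (conductorNatOf_geomPoints_eq_conductorNorm_of_not_dvd W ℓ (fun h v hv ↦ hA h v hv)
    h hℓ).symm

/-- The corrected C15 fact
`WeierstrassCurve.conductorNatOf_geomPoints_eq_conductorNorm_of_isElliptic` from
`WeierstrassCurve.artinConductorExponent_tate_eq_conductorExponent_of_isElliptic` alone.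
[cite: SilvermanATAEC1994, §IV.10 Definition of the conductor (PDF p. 364) with Thm. IV.11.1] -/
theorem _root_.WeierstrassCurve.conductorNatOf_geomPoints_eq_conductorNorm_of_isElliptic_of_tate
    (hA : W.artinConductorExponent_tate_eq_conductorExponent_of_isElliptic ℓ) :
    W.conductorNatOf_geomPoints_eq_conductorNorm_of_isElliptic ℓ :=
  fun h hℓ ↦ (conductorNorm_eq_artinConductorNat_of_isElliptic_of_tate W ℓ hA h hℓ).symm

/-- **bsd.S15 for semistable elliptic curves from the Tate-curve inputs alone.**  For a semistable
elliptic curve `E/ℚ`, the corrected fact `conductorNorm_eq_artinConductorNat_of_isElliptic W ℓ`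
(`N_E = N^{(ℓ)}(V_ℓ E)` for `ℓ ∤ N_E`) follows from Silverman *ATAEC* Thm. IV.10.2(a),(b) at the
multiplicative places only (the named facts
`codimFixed_inertia_rationalTate_eq_one_of_hasMultiplicativeReductionAt` and
`swanConductorAt_rationalTate_eq_zero_of_hasMultiplicativeReductionAt` of
`HasseWeilAbelianConductor`, both read off from the Tate curve, *ATAEC* V.5.3), the places of good
reduction being theorems (`HasseWeilAbelianConductorProofs`).  Ideal-form analogue:
`Literature.NumberTheory.EllipticCurves.conductor_eq_conductorOf_mul_of_isSemistable` (`BSDConductorIdealFormProofs`).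
[cite: SilvermanATAEC1994, Thm. IV.10.2(a),(b) (PDF p. 358) with §IV.10 Definition of the conductor (p. 364)] -/
theorem conductorNorm_eq_artinConductorNat_of_isElliptic_of_isSemistable
    (hs : W.IsSemistable (𝓞 ℚ))
    (hTm : W.codimFixed_inertia_rationalTate_eq_one_of_hasMultiplicativeReductionAt ℓ)
    (hWm : W.swanConductorAt_rationalTate_eq_zero_of_hasMultiplicativeReductionAt ℓ) :
    conductorNorm_eq_artinConductorNat_of_isElliptic W ℓ :=
  conductorNorm_eq_artinConductorNat_of_isElliptic_of_tate W ℓ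
    (W.artinConductorExponent_tate_eq_conductorExponent_of_isElliptic_of_isSemistable ℓ hs hTm hWm)

/-- **bsd.S15 (corrected) from the four bad-place facts** of `HasseWeilAbelianConductor`
(Silverman *ATAEC* Thm. IV.10.2(a) at the multiplicative and additive places, 10.2(b) at the
multiplicative places, Ogg's formula IV.11.1 at the additive places), via
`artinConductorExponent_tate_eq_conductorExponent_of_isElliptic_of_facts`
(`HasseWeilAbelianConductorProofs`) and `conductorNorm_eq_artinConductorNat_of_isElliptic_of_tate`.
Ideal-form analogue: `Literature.NumberTheory.EllipticCurves.conductor_eq_conductorOf_mul_of_facts` (`BSDConductorIdealFormProofs`).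
[cite: SilvermanATAEC1994, Thm. IV.10.2 and IV.11.1 (PDF pp. 358–366)] -/
theorem conductorNorm_eq_artinConductorNat_of_isElliptic_of_facts
    (hTm : W.codimFixed_inertia_rationalTate_eq_one_of_hasMultiplicativeReductionAt ℓ)
    (hTa : W.codimFixed_inertia_rationalTate_eq_two_of_hasAdditiveReductionAt ℓ)
    (hWm : W.swanConductorAt_rationalTate_eq_zero_of_hasMultiplicativeReductionAt ℓ)
    (hWa : W.swanConductorAt_rationalTate_eq_wildConductorExponent_of_hasAdditiveReductionAt ℓ) :
    conductorNorm_eq_artinConductorNat_of_isElliptic W ℓ :=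
  conductorNorm_eq_artinConductorNat_of_isElliptic_of_tate W ℓ
    (W.artinConductorExponent_tate_eq_conductorExponent_of_isElliptic_of_facts ℓ hTm hTa hWm hWa)

/-! ### The exponentwise schema at elliptic `W` is the corrected C15 fact

`Literature.BSD.conductorExponent_eq_artinConductorExponent W ℓ` (bsd.S15 (d), exponentwise:
`f_v(E) = a_v(V_ℓ E)` at every finite place `v ∤ ℓ` of `𝓞 ℚ`) is a schema over *all*
`W : WeierstrassCurve ℚ`: a `Prop`-valued `def` does not pick up the unused section instance
`[W.IsElliptic]` of `BSDConductor`.  The source states `f = ε + δ`, Thm. 10.2 and Ogg's formula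
11.1 for *elliptic curves* only (Silverman, *ATAEC*, §IV.10 Definition, PDF p. 358: "Let `E/K` be
an elliptic curve defined over a local field"; Definition of `𝔣(E/K)`, p. 364; 11.1, p. 365), and
over all `W` the schema is not a theorem: for a singular `W` the curve side is the junk value
`f_v = 0 + 1 - m_v = 0` at every `v` (`ord_v Δ_min = 0` for `Δ = 0`;
`KodairaSymbol.numComponents_pos`), while `geomPoints W` is Mathlib's group of non-singular points
of the cubic over `ℚ̄` — for the non-split node `y² = x³ - x²` the torus `ℚ̄ˣ` twisted by the
quadratic character `χ` of `ℚ(i)`, so `V_ℓ = ℚ_ℓ(1) ⊗ χ` is one-dimensional with `I_2` acting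
through `χ ≠ 1`, and for odd `ℓ`, `v = (2)`, the Galois side is `a_v = ⌊1 + Sw⌋₊ ≥ 1 ≠ 0 = f_v`.
So no discharge `…_holds` of the schema is possible; its content is the elliptic case, which the
two theorems below identify with the corrected C15 named fact
`WeierstrassCurve.artinConductorExponent_tate_eq_conductorExponent_of_isElliptic W ℓ`
(`HasseWeilAbelian`), itself reduced in `HasseWeilAbelianConductor` /
`HasseWeilAbelianConductorProofs` to Silverman *ATAEC* Thm. IV.10.2(a) (tame part) and Ogg's
formula IV.11.1 in its wild form at the bad places. -/

/-- **bsd.S15 (d), exponentwise form, for elliptic `W`, from the corrected C15 fact.**  For an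
*elliptic* `W / ℚ` the instance `conductorExponent_eq_artinConductorExponent W ℓ` of the schema
(`f_v(E) = a_v(V_ℓ E)` for `v ∤ ℓ`) is the corrected C15 named fact
`WeierstrassCurve.artinConductorExponent_tate_eq_conductorExponent_of_isElliptic W ℓ`
(Ogg–Saito in Galois form: Serre–Tate 1968 §2.1; Silverman *ATAEC* Thm. IV.10.2(a), PDF p. 358,
and Ogg's formula IV.11.1, PDF p. 365) read from right to left.  Binder form:
`Literature.NumberTheory.EllipticCurves.conductorExponent_eq_artinConductorExponent_of_isElliptic` (`BSDConductor`); converse: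
`WeierstrassCurve.artinConductorExponent_tate_eq_conductorExponent_of_isElliptic_of_bsd`.
[cite: SilvermanATAEC1994, §IV.10 Definition and Thm. IV.10.2 (PDF p. 358), IV.11.1 (PDF p. 365)] -/
theorem conductorExponent_eq_artinConductorExponent_of_isElliptic_of_tate [W.IsElliptic]
    (hA : W.artinConductorExponent_tate_eq_conductorExponent_of_isElliptic ℓ) :
    conductorExponent_eq_artinConductorExponent W ℓ :=
  fun h v hℓ ↦ (hA h v hℓ).symm

/-- For elliptic `W`, the schema `conductorExponent_eq_artinConductorExponent W ℓ` (bsd.S15 (d),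
exponentwise) is *equivalent* to the corrected C15 named fact
`WeierstrassCurve.artinConductorExponent_tate_eq_conductorExponent_of_isElliptic W ℓ`; hence, for
elliptic curves, it is reduced to the bad-place facts of `HasseWeilAbelianConductor`
(`conductorExponent_eq_artinConductorExponent_of_isElliptic_of_facts'` below).
[cite: SilvermanATAEC1994, Thm. IV.10.2 and IV.11.1 (PDF pp. 358, 365)] -/
theorem conductorExponent_eq_artinConductorExponent_iff_of_isElliptic [W.IsElliptic] :
    conductorExponent_eq_artinConductorExponent W ℓ ↔
      W.artinConductorExponent_tate_eq_conductorExponent_of_isElliptic ℓ :=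
  ⟨W.artinConductorExponent_tate_eq_conductorExponent_of_isElliptic_of_bsd ℓ,
    conductorExponent_eq_artinConductorExponent_of_isElliptic_of_tate W ℓ⟩

/-- **bsd.S15 (d), exponentwise, for elliptic `W`, from Thm. IV.10.2 and Ogg–Saito at `p = 2, 3`.**
For an elliptic `W / ℚ`, `conductorExponent_eq_artinConductorExponent W ℓ` follows from the five
bad-place named facts of `HasseWeilAbelianConductor`: Silverman *ATAEC* Thm. IV.10.2(a) at the
multiplicative and additive places (`hTm`, `hTa`: `codim (V_ℓ E)^{I} = 1, 2`), Thm. IV.10.2(b)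
(`hWm`: multiplicative reduction is tame; `hW5`: `Sw = 0` in residue characteristic `≠ 2, 3`) and
Ogg's formula IV.11.1 at the additive places of residue characteristic `2, 3` (`hW23`); the places
of good reduction and the bookkeeping `a_v = ⌊ε_v + δ_v⌋₊ = f_v` are theorems
(`WeierstrassCurve.artinConductorExponent_tate_eq_conductorExponent_of_isElliptic_of_facts'`,
`HasseWeilAbelianConductorProofs`).
[cite: SilvermanATAEC1994, Thm. IV.10.2 and IV.11.1 (PDF pp. 358–370)] -/
theorem conductorExponent_eq_artinConductorExponent_of_isElliptic_of_facts' [W.IsElliptic]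
    (hTm : W.codimFixed_inertia_rationalTate_eq_one_of_hasMultiplicativeReductionAt ℓ)
    (hTa : W.codimFixed_inertia_rationalTate_eq_two_of_hasAdditiveReductionAt ℓ)
    (hWm : W.swanConductorAt_rationalTate_eq_zero_of_hasMultiplicativeReductionAt ℓ)
    (hW5 : W.swanConductorAt_rationalTate_eq_zero_of_ringChar_ne ℓ)
    (hW23 : W.swanConductorAt_rationalTate_eq_wildConductorExponent_of_ringChar_eq ℓ) :
    conductorExponent_eq_artinConductorExponent W ℓ :=
  conductorExponent_eq_artinConductorExponent_of_isElliptic_of_tate W ℓ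
    (W.artinConductorExponent_tate_eq_conductorExponent_of_isElliptic_of_facts' ℓ hTm hTa hWm hW5
      hW23)

/-- **bsd.S15 (d), exponentwise, for semistable elliptic `W`, from the Tate-curve inputs alone.**
For a semistable elliptic `W / ℚ`, `conductorExponent_eq_artinConductorExponent W ℓ` follows from
Silverman *ATAEC* Thm. IV.10.2(a),(b) at the multiplicative places only
(`WeierstrassCurve.artinConductorExponent_tate_eq_conductorExponent_of_isElliptic_of_isSemistable`,
`HasseWeilAbelianConductorProofs`; Example 10.5).
[cite: SilvermanATAEC1994, Thm. IV.10.2(a),(b) and Example 10.5 (PDF pp. 358–364)] -/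
theorem conductorExponent_eq_artinConductorExponent_of_isElliptic_of_isSemistable [W.IsElliptic]
    (hs : W.IsSemistable (𝓞 ℚ))
    (hTm : W.codimFixed_inertia_rationalTate_eq_one_of_hasMultiplicativeReductionAt ℓ)
    (hWm : W.swanConductorAt_rationalTate_eq_zero_of_hasMultiplicativeReductionAt ℓ) :
    conductorExponent_eq_artinConductorExponent W ℓ :=
  conductorExponent_eq_artinConductorExponent_of_isElliptic_of_tate W ℓ
    (W.artinConductorExponent_tate_eq_conductorExponent_of_isElliptic_of_isSemistable ℓ hs hTm hWm)

end Elliptic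

end Literature.NumberTheory.EllipticCurves
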